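import Mathlib.Data.Fin.VecNotation
import Mathlib.GroupTheory.SpecificGroups.Cyclic.Basic
import Literature.AnabelianGeometry.AbsoluteAnabelian.AbsTopILem45iModelProofs
import Literature.AnabelianGeometry.AbsoluteAnabelian.FreeProSigmaCompletionBridge
import Literature.AnabelianGeometry.SemiGraphs.ProSigmaCompletionProfiniteExtend
import Literature.IUT.HodgeTheaters.PuncturedEllipticGeomOrigin
import Literature.IUT.HodgeTheaters.PuncturedEllipticCoveringsXbarRecovery
import Literature.IUT.HodgeTheaters.PuncturedEllipticCoveringsCuspsProofs
import HarnessLib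

/-!
# [IUTchI] §1 / Cor. 1.2: a free basis of `Δ_X` in STANDARD POSITION with respect to `Δ_X̲` — proof-only

Mochizuki, *Inter-universal Teichmüller theory I*, kurims manuscript (May 2020), §1 p. 37 ("`X̲ := C̲ ×_C X`", the cyclic
covering `X̲ → X` of degree `l`; the cuspidal inertia groups of `Δ_X̲`) ([IUTchI] §1 p.37) [claim: Mochizuki2012, status:
disputed]; classical input [AbsTopI] Lemma 4.5 (i) p. 54 — `Δ_X` free profinite on two generators
[cite: MochizukiAbsTopI2012, Lemma 4.5 (i) p.54] and the Nielsen move `(a, b) ↦ (a, b·a^k)`, which fixes the commutator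
`[a, b]` (folklore).  (D-0012 claim key; series status DISPUTED — PROOF-ONLY module; nothing of the series is asserted,
no side is taken on [IUTchIII] Cor. 3.12.)

Cell abc-iut, seat abc-iut-L5-d4 (gen 12), row R45 «COR12-MODL-LAWS-DERIVE@M_l», brick B4b.  For abc-iut-L5-t1's record
`PuncturedEllipticData.GeomOrigin` (free basis `a, b` of `Δ_X`, cusp inertia `⟨g [a,b] g⁻¹⟩⁻`), the shadow comparison
of abc-iut-L5-d4 (`PuncturedEllipticProLModelShadowPosition`, hypothesis (SP1)) wants the second basis element INSIDE
`Δ_X̲ = Δ_X ∩ Π_C̲`.  This file supplies it: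
* `IsFreeProOn.exists_continuous_hom_of_profinite` / `IsFreeProOn.continuous_hom_ext` — the universal property of a free
  profinite group for PROFINITE targets (existence: [SemiAnbd] Ex. 2.10 bridge; uniqueness: density of the word group);
* `IsFreeProOn.reindex`, **`IsFreeProOn.nielsen_mul_zpow`** — `(a, b·a^k)` is again a free basis (a continuous
  automorphism with continuous inverse `b ↦ b·a^{−k}`), and `[a, b·a^k] = [a, b]`;
* **`GeomOrigin.exists_standard_gens`** — for a `GeomOrigin` datum with `[Π_X : Π_X̲] = l` prime and a cusp action
  (`Π_X̲ ⊴ Π_C`): a free basis `a′, b′` of `Δ_X` with `b′ ∈ Π_C̲` and every cusp inertia group still `⟨g [a′,b′] g⁻¹⟩⁻`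
  (`Δ_X/Δ_X̲ ≅ ℤ/l`: either `a ∈ Δ_X̲` — swap — or `b·a^k ∈ Δ_X̲` for some `k` — Nielsen).
HONEST LABEL: classical group theory over OUR interfaces; no `sorry`; nothing of [IUTchI] is discharged here.
-/

noncomputable section

open Topology

namespace Literature.AnabelianGeometry.AbsoluteAnabelian

open Literature.AnabelianGeometry.SemiGraphs.SemiGraphOfAnabelioids

universe u v

section Generic

variable {G : Type u} [Group G] [TopologicalSpace G] [IsTopologicalGroup G] [CompactSpace G] [T2Space G]
  [TotallyDisconnectedSpace G] {n : ℕ} {gens : Fin n → G}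

/-- **Universal property of a free profinite group for profinite targets**: prescribed values on the free generators
extend to a CONTINUOUS homomorphism ([SemiAnbd] Ex. 2.10 bridge `exists_continuous_extend_profinite` applied to the
pro-finite completion `F_n → G`). [cite: MochizukiAbsTopI2012, Lemma 4.5 (i) p.54] -/
theorem IsFreeProOn.exists_continuous_hom_of_profinite (h : IsFreeProOn G Set.univ gens) {B : Type v} [Group B]
    [TopologicalSpace B] [IsTopologicalGroup B] [CompactSpace B] [TotallyDisconnectedSpace B] (f : Fin n → B) :
    ∃ F : G →* B, Continuous F ∧ ∀ i, F (gens i) = f i := by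
  classical
  have hι := h.isProSigmaCompletion_lift
  have hB : ∀ V : Subgroup B, V.Normal → IsOpen (V : Set B) →
      Literature.AnabelianGeometry.Anabelioids.IsSigmaInteger Set.univ V.index := by
    intro V _ hV
    haveI : Finite (B ⧸ V) := Subgroup.quotient_finite_of_isOpen V hV
    haveI : V.FiniteIndex := Subgroup.finiteIndex_of_finite_quotient
    exact ⟨Nat.pos_of_ne_zero Subgroup.FiniteIndex.index_ne_zero, fun p _ _ => Set.mem_univ p⟩
  obtain ⟨F, hFc, hF⟩ := IsProSigmaCompletion.exists_continuous_extend_profinite hι hB (FreeGroup.lift f)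
  refine ⟨F, hFc, fun i => ?_⟩
  have h := hF (FreeGroup.of i)
  rw [FreeGroup.lift_apply_of, FreeGroup.lift_apply_of] at h
  exact h

/-- **Uniqueness**: two continuous homomorphisms to a Hausdorff group that agree on the free generators agree (the word
group on the generators is dense). [cite: MochizukiAbsTopI2012, Lemma 4.5 (i) p.54] -/
theorem IsFreeProOn.continuous_hom_ext {S : Set ℕ} (h : IsFreeProOn G S gens) {B : Type v} [Group B]
    [TopologicalSpace B] [T2Space B] {F₁ F₂ : G →* B} (h₁ : Continuous F₁) (h₂ : Continuous F₂)
    (hgens : ∀ i, F₁ (gens i) = F₂ (gens i)) : F₁ = F₂ := by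
  have heq : Set.EqOn F₁ F₂ (Set.range (FreeGroup.lift gens)) := by
    rintro _ ⟨w, rfl⟩
    change (F₁.comp (FreeGroup.lift gens)) w = (F₂.comp (FreeGroup.lift gens)) w
    congr 1
    refine FreeGroup.ext_hom _ _ fun i => ?_
    rw [MonoidHom.comp_apply, MonoidHom.comp_apply, FreeGroup.lift_apply_of]
    exact hgens i
  exact MonoidHom.ext fun x => congrFun (Continuous.ext_on h.dense_range_lift h₁ h₂ heq) x

omit [IsTopologicalGroup G] [CompactSpace G] [T2Space G] [TotallyDisconnectedSpace G] in
/-- `IsFreeProOn` is invariant under re-indexing the generators. [cite: MochizukiAbsTopI2012, Lemma 4.5 (i) p.54] -/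
theorem IsFreeProOn.reindex {S : Set ℕ} (h : IsFreeProOn G S gens) (σ : Fin n ≃ Fin n) :
    IsFreeProOn G S (gens ∘ σ) := by
  refine ⟨h.1, fun K _ _ _ _ hK f => ?_⟩
  obtain ⟨φ, ⟨hφc, hφ⟩, hu⟩ := h.2 K hK (f ∘ σ.symm)
  refine ⟨φ, ⟨hφc, fun i => ?_⟩, fun ψ hψ => hu ψ ⟨hψ.1, fun i => ?_⟩⟩
  · rw [Function.comp_apply, hφ, Function.comp_apply, Equiv.symm_apply_apply]
  · have e := hψ.2 (σ.symm i)
    rw [Function.comp_apply, Equiv.apply_symm_apply] at e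
    rw [e, Function.comp_apply]

/-- **The Nielsen move `(a, b) ↦ (a, b·a^k)` preserves free bases** of a free profinite group on two generators: the
substitution is a continuous automorphism (inverse `b ↦ b·a^{−k}`), and `IsFreeProOn` is transported along it.
[cite: MochizukiAbsTopI2012, Lemma 4.5 (i) p.54] -/
theorem IsFreeProOn.nielsen_mul_zpow {gens : Fin 2 → G} (h : IsFreeProOn G Set.univ gens) (k : ℤ) :
    IsFreeProOn G Set.univ ![gens 0, gens 1 * gens 0 ^ k] := by
  obtain ⟨σ, hσ, hσg⟩ := h.exists_continuous_hom_of_profinite ![gens 0, gens 1 * gens 0 ^ k]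
  obtain ⟨τ, hτ, hτg⟩ := h.exists_continuous_hom_of_profinite ![gens 0, gens 1 * gens 0 ^ (-k)]
  have hσ0 : σ (gens 0) = gens 0 := by rw [hσg 0]; rfl
  have hσ1 : σ (gens 1) = gens 1 * gens 0 ^ k := by rw [hσg 1]; rfl
  have hτ0 : τ (gens 0) = gens 0 := by rw [hτg 0]; rfl
  have hτ1 : τ (gens 1) = gens 1 * gens 0 ^ (-k) := by rw [hτg 1]; rfl
  have hτσ : τ.comp σ = MonoidHom.id G := by
    refine h.continuous_hom_ext (hτ.comp hσ) continuous_id fun i => ?_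
    fin_cases i
    · change τ (σ (gens 0)) = gens 0
      rw [hσ0, hτ0]
    · change τ (σ (gens 1)) = gens 1
      rw [hσ1, map_mul, map_zpow, hτ1, hτ0, mul_assoc, ← zpow_add, neg_add_cancel, zpow_zero, mul_one]
  have hστ : σ.comp τ = MonoidHom.id G := by
    refine h.continuous_hom_ext (hσ.comp hτ) continuous_id fun i => ?_
    fin_cases i
    · change σ (τ (gens 0)) = gens 0
      rw [hτ0, hσ0]
    · change σ (τ (gens 1)) = gens 1
      rw [hτ1, map_mul, map_zpow, hσ1, hσ0, mul_assoc, ← zpow_add, add_neg_cancel, zpow_zero, mul_one]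
  let e : G ≃ₜ* G :=
    { toFun := σ
      invFun := τ
      left_inv := fun x => by change (τ.comp σ) x = x; rw [hτσ]; rfl
      right_inv := fun x => by change (σ.comp τ) x = x; rw [hστ]; rfl
      map_mul' := σ.map_mul
      continuous_toFun := hσ
      continuous_invFun := hτ }
  have himg : (fun i => e (gens i)) = ![gens 0, gens 1 * gens 0 ^ k] := by
    funext i
    fin_cases i
    · exact hσ0
    · exact hσ1
  rw [← himg]
  exact h.of_continuousMulEquiv e

omit [TopologicalSpace G] [IsTopologicalGroup G] [CompactSpace G] [T2Space G] [TotallyDisconnectedSpace G] in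
/-- The Nielsen move fixes the commutator: `[a, b·a^k] = [a, b]`. [cite: MochizukiAbsTopI2012, Lemma 4.5 (i) p.54] -/
theorem commutator_nielsen_mul_zpow (a b : G) (k : ℤ) :
    a * (b * a ^ k) * a⁻¹ * (b * a ^ k)⁻¹ = a * b * a⁻¹ * b⁻¹ := by
  group

end Generic

end Literature.AnabelianGeometry.AbsoluteAnabelian

namespace Literature.IUT.HodgeTheaters

namespace PuncturedEllipticData

open Literature.AnabelianGeometry.AbsoluteAnabelian

universe u

variable {D : PuncturedEllipticData.{u}}

/-! ### `Δ_X̲ ⊴ Δ_X` of index `l` -/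

/-- `Δ_X̲ = Δ_X ∩ Π_C̲` is normal in `Δ_X` (given a cusp action: `Π_X̲ ⊴ Π_C`). ([IUTchI] §1 p.37)
[claim: Mochizuki2012, status: disputed] -/
theorem CuspGalois.normal_deltaXbar_subgroupOf (C : D.CuspGalois) :
    (D.DeltaXbar.subgroupOf (D.PiX ⊓ D.DeltaC)).Normal := by
  haveI := C.normal_PiXbar
  haveI : D.DeltaC.Normal := inferInstanceAs D.E.geom.Normal
  haveI : D.DeltaXbar.Normal := inferInstanceAs (D.PiXbar ⊓ D.DeltaC).Normal
  exact Subgroup.Normal.subgroupOf inferInstance _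

/-- `[Δ_X : Δ_X̲] = l` from `[Π_X : Π_X̲] = l` (abc-iut's `relIndex_deltaXbar_deltaX_of_hX`), in `index` currency.
([IUTchI] §1 p.37) [claim: Mochizuki2012, status: disputed] -/
theorem index_deltaXbar_subgroupOf_of_hX (hX : D.PiXbar.relIndex D.PiX = D.l) :
    (D.DeltaXbar.subgroupOf (D.PiX ⊓ D.DeltaC)).index = D.l :=
  relIndex_deltaXbar_deltaX_of_hX hX

/-- Membership in `Δ_X̲ ⊆ Δ_X`: an element of `Δ_X` lies in `Δ_X̲` iff it lies in `Π_C̲`. ([IUTchI] §1 p.37)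
[claim: Mochizuki2012, status: disputed] -/
theorem mem_deltaXbar_subgroupOf_iff (g : ↥(D.PiX ⊓ D.DeltaC)) :
    g ∈ D.DeltaXbar.subgroupOf (D.PiX ⊓ D.DeltaC) ↔ (g : D.PiC) ∈ D.PiCbar := by
  rw [Subgroup.mem_subgroupOf, DeltaXbar, PiXbar, Subgroup.mem_inf, Subgroup.mem_inf]
  exact ⟨fun h => h.1.2, fun h => ⟨⟨g.2.1, h⟩, g.2.2⟩⟩

/-! ### The standard free basis -/

namespace GeomOrigin

/-- **A free basis of `Δ_X` in standard position.**  For abc-iut-L5-t1's `GeomOrigin` datum (free basis `a, b` of `Δ_X`,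
cusp inertia `⟨g [a,b] g⁻¹⟩⁻`) with a cusp action and `[Π_X : Π_X̲] = l` prime, there is a free basis `a′, b′` of `Δ_X`
with `b′ ∈ Π_C̲` (i.e. `b′ ∈ Δ_X̲`) such that every cusp inertia group is still `⟨g [a′,b′] g⁻¹⟩⁻`, `g ∈ Δ_X`:
`Δ_X/Δ_X̲` is cyclic of prime order, so either `a ∈ Δ_X̲` (take `(b, a)`, `[b,a] = [a,b]⁻¹`) or `b·a^k ∈ Δ_X̲` for some
`k` (take `(a, b·a^k)`, a free basis by the Nielsen move, `[a, b·a^k] = [a,b]`). ([IUTchI] §1 p.37)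
[claim: Mochizuki2012, status: disputed] -/
theorem exists_standard_gens (O : D.GeomOrigin) (C : D.CuspGalois) (hl : D.l.Prime)
    (hX : D.PiXbar.relIndex D.PiX = D.l) :
    ∃ gens : Fin 2 → ↥(D.PiX ⊓ D.DeltaC), IsFreeProOn ↥(D.PiX ⊓ D.DeltaC) Set.univ gens ∧
      (gens 1 : D.PiC) ∈ D.PiCbar ∧
      ∀ x : D.Cusp, ∃ g ∈ D.PiX ⊓ D.DeltaC, D.inertia x =
        (Subgroup.zpowers (g * ((gens 0 : D.PiC) * (gens 1 : D.PiC) * (gens 0 : D.PiC)⁻¹ * (gens 1 : D.PiC)⁻¹) *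
          g⁻¹)).topologicalClosure := by
  classical
  haveI : Fact D.l.Prime := ⟨hl⟩
  haveI : CompactSpace ↥(D.PiX ⊓ D.DeltaC) := isCompact_iff_compactSpace.mp D.isClosed_piX_inf_deltaC.isCompact
  set N := D.DeltaXbar.subgroupOf (D.PiX ⊓ D.DeltaC) with hN
  haveI hNn : N.Normal := C.normal_deltaXbar_subgroupOf
  have hcard : Nat.card (↥(D.PiX ⊓ D.DeltaC) ⧸ N) = D.l := by
    rw [← Subgroup.index_eq_card]; exact index_deltaXbar_subgroupOf_of_hX hX
  set a := O.gens 0 with ha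
  set b := O.gens 1 with hb
  by_cases haC : (a : D.PiC) ∈ D.PiCbar
  · -- swap: `(b, a)`
    refine ⟨O.gens ∘ Equiv.swap 0 1, O.isFreeProOn.reindex _, ?_, fun x => ?_⟩
    · change ((O.gens (Equiv.swap (0 : Fin 2) 1 1)) : D.PiC) ∈ D.PiCbar
      rw [Equiv.swap_apply_right]; exact haC
    · obtain ⟨g, hg, hI⟩ := O.inertia_eq_conj_commutator x
      refine ⟨g, hg, ?_⟩
      rw [hI, Function.comp_apply, Function.comp_apply, Equiv.swap_apply_left, Equiv.swap_apply_right,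
        ← Subgroup.zpowers_inv]
      congr 2
      simp only [mul_inv_rev, inv_inv, mul_assoc]
  · -- Nielsen: `(a, b·a^k)` with `b·a^k ∈ Δ_X̲`
    have ha1 : (a : ↥(D.PiX ⊓ D.DeltaC) ⧸ N) ≠ 1 := fun h =>
      haC ((mem_deltaXbar_subgroupOf_iff a).1 ((QuotientGroup.eq_one_iff a).1 h))
    obtain ⟨k, hk⟩ := Subgroup.mem_zpowers_iff.mp
      (mem_zpowers_of_prime_card hcard ha1 (g' := ((b : ↥(D.PiX ⊓ D.DeltaC) ⧸ N))⁻¹))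
    have hbk : b * a ^ k ∈ N := by
      rw [← QuotientGroup.eq_one_iff, QuotientGroup.mk_mul, QuotientGroup.mk_zpow, hk, mul_inv_cancel]
    refine ⟨![a, b * a ^ k], O.isFreeProOn.nielsen_mul_zpow k, ?_, fun x => ?_⟩
    · exact (mem_deltaXbar_subgroupOf_iff _).1 hbk
    · obtain ⟨g, hg, hI⟩ := O.inertia_eq_conj_commutator x
      refine ⟨g, hg, ?_⟩
      have hc : ((![a, b * a ^ k] 0 : ↥(D.PiX ⊓ D.DeltaC)) : D.PiC) * ((![a, b * a ^ k] 1 : ↥(D.PiX ⊓ D.DeltaC)) : D.PiC) *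
          (((![a, b * a ^ k] 0 : ↥(D.PiX ⊓ D.DeltaC)) : D.PiC))⁻¹ * (((![a, b * a ^ k] 1 : ↥(D.PiX ⊓ D.DeltaC)) : D.PiC))⁻¹ =
          (a : D.PiC) * (b : D.PiC) * (a : D.PiC)⁻¹ * (b : D.PiC)⁻¹ := by
        simp only [Matrix.cons_val_zero, Matrix.cons_val_one, Subgroup.coe_mul, SubgroupClass.coe_zpow]
        exact commutator_nielsen_mul_zpow _ _ _
      rw [hI, hc]

end GeomOrigin

end PuncturedEllipticData

end Literature.IUT.HodgeTheaters
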